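import Literature.NumberTheory.DiophantineGeometry.CatalanObstruction
import Literature.NumberTheory.DiophantineGeometry.CatalanWieferich
import Mathlib.NumberTheory.NumberField.Cyclotomic.Galois
import Mathlib.NumberTheory.NumberField.CMField
import HarnessLib

/-!
# From Stickelberger annihilation to Mihăilescu's Theorem I (Schoof, Proposition 10.1)

[Schoof2009, Proposition 10.1] combines three inputs to show that for a non-zero solution of
Catalan's equation and an element `θ` of the ideal `(1 - ι)𝒮` (`𝒮` the Stickelberger ideal of
`ℤ[Gal(ℚ(ζ_p)/ℚ)]`, `ι` complex conjugation) the number `(x - ζ_p)^θ` is a `q`-th power in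
`ℚ(ζ_p)`:

1. `(x - ζ_p) = 𝔭 𝔞^q` as ideals ([Schoof2009, Propositions 7.2, 7.3] — `Catalan.span_sub_zeta_pow_eq`);
2. **Stickelberger's theorem** [Schoof2009, Theorem 9.6]: `𝒮` annihilates the class group, so
   `𝔞^θ'` is principal for `θ' ∈ 𝒮`;
3. [Schoof2009, Lemma 7.1 (ii)]: for a unit (indeed a `p`-unit) `ε`, `ε^(1-ι)` is a root of
   unity (Kronecker), and the roots of unity of `ℚ(ζ_p)` have order `2p`, prime to `q`, so they
   are `q`-th powers.

This file carries out this deduction for the Stickelberger element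
`θ' = ι θ₂ = Σ_{1 ≤ a ≤ (p-1)/2} σ_a⁻¹` (`θ₂ = Σ_a ⌊2a/p⌋ σ_a⁻¹ = f₁ ∈ 𝒮`,
[Schoof2009, Proposition 9.2]), taking the annihilation statement (2) for this one element as an
explicit hypothesis `hKS` — "for every ideal `𝔟` of `ℤ[ζ_p]`, `∏_{1 ≤ a ≤ (p-1)/2} σ_a⁻¹(𝔟)` is
principal" (Kummer 1847 / Stickelberger 1890; for prime ideals of degree one it is the prime
factorisation of the Jacobi sum `J(χ, χ)`) — and proving everything else: the Galois
bookkeeping, the unit argument via Mathlib's CM-field API (`IsCMField.unitsMulComplexConjInv`),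
`#μ(ℚ(ζ_p)) = 2p` (`IsCyclotomicExtension.Rat.torsionOrder_eq`), and the passage to the shape
`∏_{1 ≤ i < p} (1 - ζ_p^i x)^(nᵢ) = β^q` with `n_{p-1} = 1` consumed by
`Catalan.isWieferich_of_prod_one_sub_zeta_pow_mul_eq_pow` (`CatalanWieferich`, Theorem 10.2 and
Theorem I). The outcome, `Catalan.isWieferich_of_kummerStickelberger`, is:

  *Stickelberger annihilation for `ι θ₂` in the `p`-th and in the `q`-th cyclotomic fields implies
  Mihăilescu's Theorem I for the pair `(p, q)`.*

No named fact is introduced; the annihilation statement enters only as a hypothesis.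

## References

* R. Schoof, *Catalan's Conjecture*, Universitext, Springer 2009 [Schoof2009], Lemma 7.1,
  Propositions 9.2, 10.1, Theorem 10.2, Theorem I (book pp. 42, 56, 67–68) — held,
  `lit read book:schoof2009-catalan-s-conjecture` (PDF pp. 121, 139, 148–149).
* P. Mihăilescu, *A class number free criterion for Catalan's conjecture*, J. Number Theory
  **99** (2003), 225–231.
-/

namespace Literature.NumberTheory.DiophantineGeometry

namespace Catalan

open Finset NumberField

open scoped Pointwise

/-! ### Small generalities -/

/-- An element of finite order prime to `q` is a `q`-th power. [folklore] -/
theorem exists_eq_pow_of_pow_eq_one_of_coprime {M : Type*} [Monoid M] {ν : M} {N q : ℕ}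
    (hN : ν ^ N = 1) (hcop : q.Coprime N) (hN1 : 1 < N) : ∃ ρ : M, ν = ρ ^ q := by
  obtain ⟨s, -, hs⟩ := Nat.exists_mul_mod_eq_one_of_coprime hcop hN1
  refine ⟨ν ^ s, ?_⟩
  rw [← pow_mul, mul_comm s q]
  conv_lhs => rw [← pow_one ν, ← hs]
  conv_rhs => rw [← Nat.div_add_mod (q * s) N, pow_add, pow_mul, hN, one_pow, one_mul]

/-- Regrouping a product along the fibres of an index map. [folklore] -/
theorem prod_comp_eq_prod_pow_card {M : Type*} [CommMonoid M] {α β : Type*} [DecidableEq β]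
    (S : Finset α) (T : Finset β) (e : α → β) (he : ∀ a ∈ S, e a ∈ T) (f : β → M) :
    ∏ a ∈ S, f (e a) = ∏ i ∈ T, f i ^ (S.filter (fun a => e a = i)).card := by
  rw [← prod_fiberwise_of_maps_to he]
  refine prod_congr rfl fun i _ => ?_
  rw [← prod_const]
  exact prod_congr rfl fun a ha => by rw [(mem_filter.mp ha).2]

section Cyclotomic

variable {p : ℕ} [hp : Fact p.Prime] {K : Type*} [Field K] [NumberField K]
  [IsCyclotomicExtension {p} ℚ K] {ζ : K} (hζ : IsPrimitiveRoot ζ p)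

/-! ### The Galois action on `ℤ[ζ_p]` and its ideals -/

omit hp [IsCyclotomicExtension {p} ℚ K] in
/-- Galois automorphisms fix (the images of) integers. [folklore] -/
theorem smul_intCast_ringOfIntegers (τ : K ≃ₐ[ℚ] K) (n : ℤ) : τ • (n : 𝓞 K) = n := by
  rw [← MulSemiringAction.toRingHom_apply, map_intCast]

omit hp [IsCyclotomicExtension {p} ℚ K] in
/-- The action on a principal ideal. [folklore] -/
theorem smul_span_singleton_ringOfIntegers (τ : K ≃ₐ[ℚ] K) (r : 𝓞 K) :
    τ • Ideal.span {r} = Ideal.span {τ • r} := by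
  rw [Ideal.pointwise_smul_def, Ideal.map_span, Set.image_singleton,
    MulSemiringAction.toRingHom_apply]

/-- `σ_b (ζ) = ζ^b`: the automorphism attached to `b ∈ (ℤ/p)ˣ` by `galEquivZMod` raises `ζ_p`
(in `𝓞 K`) to the power `b`. [folklore] -/
theorem galEquivZMod_symm_smul_toInteger (b : (ZMod p)ˣ) :
    (IsCyclotomicExtension.Rat.galEquivZMod p K).symm b • hζ.toInteger
      = hζ.toInteger ^ (b : ZMod p).val := by
  rw [IsCyclotomicExtension.Rat.galEquivZMod_smul_of_pow_eq p K _
    hζ.toInteger_isPrimitiveRoot.pow_eq_one, MulEquiv.apply_symm_apply]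

/-- Galois automorphisms fix the prime `𝔭 = (ζ_p - 1)` above `p`. [folklore] -/
theorem smul_span_zeta_sub_one (τ : K ≃ₐ[ℚ] K) :
    τ • Ideal.span {hζ.toInteger - 1} = Ideal.span {hζ.toInteger - 1} := by
  set b := IsCyclotomicExtension.Rat.galEquivZMod p K τ with hb
  have hτ : τ = (IsCyclotomicExtension.Rat.galEquivZMod p K).symm b := by
    rw [hb, MulEquiv.symm_apply_apply]
  rw [smul_span_singleton_ringOfIntegers, smul_sub, smul_one, hτ,
    galEquivZMod_symm_smul_toInteger hζ]
  refine (Ideal.span_singleton_eq_span_singleton.mpr ?_).symm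
  refine hζ.toInteger_isPrimitiveRoot.associated_sub_one_pow_sub_one_of_coprime ?_
  have h0 : (b : ZMod p).val ≠ 0 := by
    rw [Ne, ZMod.val_eq_zero]
    exact b.ne_zero
  exact (Nat.coprime_of_lt_prime h0 (ZMod.val_lt _) hp.out).symm

/-! ### Complex conjugation and roots of unity in `ℚ(ζ_p)` -/

omit [IsCyclotomicExtension {p} ℚ K] in
include hζ in
/-- Complex conjugation of the CM field `ℚ(ζ_p)` inverts `ζ_p`. [folklore] -/
theorem complexConj_zeta [IsCMField K] : IsCMField.complexConj K ζ = ζ⁻¹ := by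
  let φ : K →+* ℂ := Classical.choice (inferInstance : Nonempty _)
  apply φ.injective
  rw [IsCMField.complexEmbedding_complexConj, map_inv₀]
  have h1 : ‖φ ζ‖ = 1 := (hζ.map_of_injective φ.injective).norm'_eq_one hp.out.ne_zero
  exact (Complex.inv_eq_conj h1).symm

/-- A root of unity of `ℚ(ζ_p)` (`p` an odd prime) has order dividing `2p`
(`#μ(ℚ(ζ_p)) = 2p`). [cite: Schoof2009, Lemma 7.1 (proof)] -/
theorem pow_two_mul_eq_one_of_mem_torsion (hpo : Odd p) {μ : (𝓞 K)ˣ} (hμ : μ ∈ Units.torsion K) :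
    (μ : 𝓞 K) ^ (2 * p) = 1 := by
  have hord : Units.torsionOrder K = 2 * p := by
    rw [IsCyclotomicExtension.Rat.torsionOrder_eq (n := p) (K := K), if_neg]
    exact Nat.not_even_iff_odd.mpr hpo
  rw [← Units.rootsOfUnity_eq_torsion, mem_rootsOfUnity, hord] at hμ
  rw [← Units.val_pow_eq_pow_val, hμ, Units.val_one]

/-! ### Proposition 10.1 for `θ = (1 - ι) ι θ₂`: from annihilation to a `q`-th power -/

/-- **[Schoof2009, Proposition 10.1] for the Stickelberger element `ι θ₂`, made explicit.**
Let `p ≠ q` be odd primes, `K` a `p`-th cyclotomic field, `ζ = ζ_p`, `𝔭 = (ζ - 1)`, and `x` an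
integer such that `(x - ζ) = 𝔭 · 𝔞 ^ q` for an ideal `𝔞` of `𝓞 K` (for a non-zero solution of
Catalan's equation this is [Schoof2009, Propositions 7.2–7.3], `Catalan.span_sub_zeta_pow_eq`).
Assume the annihilation statement of Stickelberger's theorem [Schoof2009, Theorem 9.6] for the
element `ι θ₂ = Σ_{1 ≤ a ≤ (p-1)/2} σ_a⁻¹` of the Stickelberger ideal and the ideal `𝔞`:
`∏_{1 ≤ a ≤ (p-1)/2} σ_a⁻¹(𝔞)` is principal (`σ_a : ζ ↦ ζ^a`). Then there are exponents
`nᵢ ≥ 0` with `n_{p-1} = 1` and an algebraic integer `β` with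
`∏_{1 ≤ i < p} (1 - ζ^i x)^(nᵢ) = β ^ q` — the element `(x - ζ)^θ`, `θ = (1 - ι) ι θ₂` shifted by
a multiple of `q` times the norm element, is a `q`-th power [Schoof2009, proof of Proposition 10.1:
`𝔞^(ιθ₂) = (γ)`, so `(x - ζ)^(ιθ₂) = ε (ζ-1)^((p-1)/2) γ^q` with a unit `ε`; `ε^(1-ι)` and
`(ζ - 1)^(1-ι) = -ζ` are roots of unity of order dividing `2p` (Lemma 7.1 (ii)), hence `q`-th
powers]. [cite: Schoof2009, Proposition 10.1] -/
theorem exists_prod_one_sub_zeta_pow_mul_eq_pow_of_isPrincipal (hpo : Odd p) {q : ℕ}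
    (hq : q.Prime) (hqo : Odd q) (hpq : p ≠ q) (x : ℤ) {𝔞 : Ideal (𝓞 K)}
    (hA : Ideal.span {(x : 𝓞 K) - hζ.toInteger} = Ideal.span {hζ.toInteger - 1} * 𝔞 ^ q)
    (hKS : (∏ a ∈ Finset.univ.filter (fun a : (ZMod p)ˣ => (a : ZMod p).val ≤ (p - 1) / 2),
      (IsCyclotomicExtension.Rat.galEquivZMod p K).symm a⁻¹ • 𝔞).IsPrincipal) :
    ∃ (n : ℕ → ℕ) (β : 𝓞 K), n (p - 1) = 1 ∧
      ∏ i ∈ Ico 1 p, (1 - hζ.toInteger ^ i * x) ^ n i = β ^ q := by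
  classical
  -- notation and elementary facts
  haveI : Fact (1 < p) := ⟨hp.out.one_lt⟩
  have hp3 : 3 ≤ p := by
    have := hp.out.two_le
    obtain ⟨k, hk⟩ := hpo
    omega
  obtain ⟨k, hk⟩ : ∃ k, p = k + 1 := ⟨p - 1, by omega⟩
  obtain ⟨r, hr⟩ : ∃ r, q = r + 1 := ⟨q - 1, by have := hq.one_lt; omega⟩
  have hcop2p : q.Coprime (2 * p) := by
    refine Nat.Coprime.mul_right ?_ ?_
    · exact (Nat.coprime_primes hq Nat.prime_two).mpr fun h => by
        subst h; exact (Nat.not_even_iff_odd.mpr hqo) even_two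
    · exact (Nat.coprime_primes hq hp.out).mpr (Ne.symm hpq)
  have h2p : 1 < 2 * p := by omega
  set σ_ := (IsCyclotomicExtension.Rat.galEquivZMod p K).symm with hσdef
  set S : Finset (ZMod p)ˣ := Finset.univ.filter (fun a : (ZMod p)ˣ => (a : ZMod p).val ≤ (p - 1) / 2)
    with hSdef
  set z : 𝓞 K := hζ.toInteger with hzdef
  have hz : IsPrimitiveRoot z p := hζ.toInteger_isPrimitiveRoot
  have hzp : z ^ p = 1 := hz.pow_eq_one
  have hz0 : z ≠ 0 := hz.ne_zero hp.out.ne_zero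
  have hzk : z ^ k * z = 1 := by rw [← pow_succ, ← hk, hzp]
  set π : 𝓞 K := z - 1 with hπdef
  -- the exponents `m a = a⁻¹ mod p ∈ [1, p-1]`, with `σ_ a⁻¹ • z = z ^ m a`
  set m : (ZMod p)ˣ → ℕ := fun a => ((a⁻¹ : (ZMod p)ˣ) : ZMod p).val with hmdef
  have hm1 : ∀ a, 1 ≤ m a := fun a => by
    rw [hmdef]; simp only
    rw [Nat.one_le_iff_ne_zero, Ne, ZMod.val_eq_zero]
    exact (a⁻¹).ne_zero
  have hmp : ∀ a, m a < p := fun a => ZMod.val_lt _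
  have hmIco : ∀ a ∈ S, m a ∈ Ico 1 p := fun a _ => mem_Ico.mpr ⟨hm1 a, hmp a⟩
  have hmIco' : ∀ a ∈ S, p - m a ∈ Ico 1 p := fun a _ => by
    have := hm1 a; have := hmp a; rw [mem_Ico]; omega
  have hσz : ∀ a, σ_ a⁻¹ • z = z ^ m a := fun a => galEquivZMod_symm_smul_toInteger hζ a⁻¹
  -- Step 1: conjugates of the ideal equation
  have hconj : ∀ a, Ideal.span {(x : 𝓞 K) - z ^ m a} = Ideal.span {π} * (σ_ a⁻¹ • 𝔞) ^ q := by
    intro a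
    have := congrArg (fun I : Ideal (𝓞 K) => σ_ a⁻¹ • I) hA
    rwa [smul_mul', smul_pow', smul_span_zeta_sub_one hζ, smul_span_singleton_ringOfIntegers,
      smul_sub, smul_intCast_ringOfIntegers, hσz a] at this
  -- Step 2: product over `S`; `E = ∏ (x - z^(m a))` generates `𝔭^#S (γ)^q`
  set E : 𝓞 K := ∏ a ∈ S, ((x : 𝓞 K) - z ^ m a) with hEdef
  obtain ⟨γ, hγ⟩ : ∃ γ : 𝓞 K, ∏ a ∈ S, σ_ a⁻¹ • 𝔞 = Ideal.span {γ} :=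
    ⟨_, (Ideal.span_singleton_generator _).symm⟩
  have hEideal : Ideal.span {E} = Ideal.span {π ^ S.card * γ ^ q} := by
    rw [hEdef, ← Ideal.prod_span_singleton, prod_congr rfl fun a _ => hconj a, prod_mul_distrib,
      prod_const, prod_pow, hγ, Ideal.span_singleton_pow, Ideal.span_singleton_pow,
      Ideal.span_singleton_mul_span_singleton]
  obtain ⟨u, hu⟩ : ∃ u : (𝓞 K)ˣ, π ^ S.card * γ ^ q * u = E :=
    Ideal.span_singleton_eq_span_singleton.mp hEideal.symm
  -- Step 3: complex conjugation `cc` on `𝓞 K`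
  haveI : IsCMField K :=
    IsCyclotomicExtension.Rat.isCMField K (S := {p}) ⟨p, Set.mem_singleton p, by omega⟩
  set cc : 𝓞 K →+* 𝓞 K :=
    (RingOfIntegers.mapRingEquiv (IsCMField.complexConj K).toRingEquiv).toRingHom with hccdef
  have hcc_coe : ∀ w : 𝓞 K, ((cc w : 𝓞 K) : K) = IsCMField.complexConj K (w : K) := fun w => rfl
  have hccz : cc z = z ^ k := by
    apply RingOfIntegers.ext
    have h1 : (ζ ^ k) * ζ = 1 := by rw [← pow_succ, ← hk, hζ.pow_eq_one]
    calc ((cc z : 𝓞 K) : K) = IsCMField.complexConj K ζ := rfl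
      _ = ζ⁻¹ := complexConj_zeta hζ
      _ = ζ ^ k := (eq_inv_of_mul_eq_one_left h1).symm
      _ = ((z ^ k : 𝓞 K) : K) := by
        rw [hzdef, RingOfIntegers.coe_eq_algebraMap, map_pow]; rfl
  have hccx : cc (x : 𝓞 K) = x := map_intCast cc x
  have hccπ : cc π = -z ^ k * π := by
    rw [hπdef, map_sub, map_one, hccz]
    linear_combination hzk
  have hccpow : ∀ j, 1 ≤ j → j < p → cc ((x : 𝓞 K) - z ^ j) = x - z ^ (p - j) := by
    intro j hj1 hjp
    rw [map_sub, hccx, map_pow, hccz, ← pow_mul]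
    congr 1
    apply mul_right_cancel₀ (pow_ne_zero j hz0)
    rw [← pow_add, ← pow_add, Nat.sub_add_cancel hjp.le, hzp, show k * j + j = p * j by
      rw [hk]; ring, pow_mul, hzp, one_pow]
  set Ebar : 𝓞 K := ∏ a ∈ S, ((x : 𝓞 K) - z ^ (p - m a)) with hEbardef
  have hccE : cc E = Ebar := by
    rw [hEdef, map_prod]
    exact prod_congr rfl fun a _ => hccpow (m a) (hm1 a) (hmp a)
  -- the unit `u`: `u = μ · cc u` with `μ` a root of unity, `μ^(2p) = 1`
  set μ : 𝓞 K := ((IsCMField.unitsMulComplexConjInv K u : (𝓞 K)ˣ) : 𝓞 K) with hμdef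
  have hμ2p : μ ^ (2 * p) = 1 :=
    pow_two_mul_eq_one_of_mem_torsion hpo (IsCMField.unitsMulComplexConjInv K u).2
  have huμ : (u : 𝓞 K) = μ * cc u := by
    have h1 : ((IsCMField.unitsMulComplexConjInv K u : (𝓞 K)ˣ)) * IsCMField.unitsComplexConj K u
        = u := by
      rw [IsCMField.unitsMulComplexConjInv_apply, inv_mul_cancel_right]
    have h2 := congrArg Units.val h1
    rw [Units.val_mul] at h2
    calc (u : 𝓞 K) = _ := h2.symm
      _ = μ * cc u := rfl
  -- Step 4: `E · (cc E)^(q-1)` is a root of unity times a `q`-th power, hence a `q`-th power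
  set ν : 𝓞 K := μ * (-z ^ k) ^ (S.card * r) with hνdef
  set β₀ : 𝓞 K := cc u * π ^ S.card * γ * cc γ ^ r with hβ₀def
  have hkey : E * Ebar ^ r = ν * β₀ ^ q := by
    have hE' : E = π ^ S.card * γ ^ q * (μ * cc u) := by rw [← huμ, hu]
    have hEbar' : Ebar = (-z ^ k * π) ^ S.card * cc γ ^ q * cc u := by
      rw [← hccE, ← hu, map_mul, map_mul, map_pow, map_pow, hccπ]
    rw [hE', hEbar', hνdef, hβ₀def, hr]
    ring
  have hν2p : ν ^ (2 * p) = 1 := by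
    have h1 : (-z ^ k) ^ (2 * p) = 1 := by
      rw [pow_mul, neg_sq, ← pow_mul, ← pow_mul, show k * (2 * p) = p * (2 * k) by ring, pow_mul,
        hzp, one_pow]
    rw [hνdef, mul_pow, hμ2p, one_mul, ← pow_mul, mul_comm (S.card * r), pow_mul, h1, one_pow]
  obtain ⟨ν₁, hν₁⟩ := exists_eq_pow_of_pow_eq_one_of_coprime hν2p hcop2p h2p
  -- Step 5: `E · Ebar^(q-1) = ∏_{1 ≤ i < p} (x - z^i)^(n i)`
  set n : ℕ → ℕ := fun i => (S.filter (fun a => m a = i)).card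
    + r * (S.filter (fun a => p - m a = i)).card with hndef
  have hprodn : ∏ i ∈ Ico 1 p, ((x : 𝓞 K) - z ^ i) ^ n i = E * Ebar ^ r := by
    have h1 := prod_comp_eq_prod_pow_card S (Ico 1 p) m hmIco (fun i => (x : 𝓞 K) - z ^ i)
    have h2 := prod_comp_eq_prod_pow_card S (Ico 1 p) (fun a => p - m a) hmIco'
      (fun i => (x : 𝓞 K) - z ^ i)
    rw [hEdef, hEbardef, h1, h2, ← prod_pow, ← prod_mul_distrib]
    refine prod_congr rfl fun i _ => ?_
    rw [hndef]
    simp only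
    rw [pow_add, pow_mul, ← pow_mul, ← pow_mul, mul_comm r]
  -- Step 6: pass to the factors `1 - z^j x = (-z^j) (x - z^(p-j))`
  have hfac : ∀ i, 1 ≤ i → i < p → (1 : 𝓞 K) - z ^ (p - i) * x = (-z ^ (p - i)) * (x - z ^ i) := by
    intro i hi1 hip
    have : z ^ (p - i) * z ^ i = 1 := by rw [← pow_add, Nat.sub_add_cancel hip.le, hzp]
    linear_combination (-1 : 𝓞 K) * this
  set ρ : 𝓞 K := ∏ i ∈ Ico 1 p, (-z ^ (p - i)) ^ n i with hρdef
  have hρ2p : ρ ^ (2 * p) = 1 := by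
    rw [hρdef, ← prod_pow]
    refine prod_eq_one fun i _ => ?_
    have hw : (-z ^ (p - i)) ^ (2 * p) = 1 := by
      rw [pow_mul, neg_sq, ← pow_mul, ← pow_mul, show (p - i) * (2 * p) = p * ((p - i) * 2) by ring,
        pow_mul, hzp, one_pow]
    rw [← pow_mul, mul_comm (n i) (2 * p), pow_mul, hw, one_pow]
  obtain ⟨ρ₁, hρ₁⟩ := exists_eq_pow_of_pow_eq_one_of_coprime hρ2p hcop2p h2p
  refine ⟨fun j => n (p - j), ρ₁ * ν₁ * β₀, ?_, ?_⟩
  · -- `n 1 = 1`: only `a = 1` has `m a = 1`, and no `a ∈ S` has `m a = p - 1`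
    show n (p - (p - 1)) = 1
    rw [show p - (p - 1) = 1 by omega, hndef]
    simp only
    have hval1 : ∀ b : (ZMod p)ˣ, (b : ZMod p).val = 1 ↔ b = 1 := fun b => by
      constructor
      · intro h
        have : (b : ZMod p) = 1 := by
          rw [← ZMod.natCast_zmod_val (b : ZMod p), h, Nat.cast_one]
        exact Units.val_eq_one.mp this
      · rintro rfl
        rw [Units.val_one, ZMod.val_one]
    have hS1 : S.filter (fun a => m a = 1) = {1} := by
      ext a
      rw [mem_filter, mem_singleton, hSdef, mem_filter, hmdef]
      simp only [mem_univ, true_and]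
      rw [hval1, inv_eq_one]
      constructor
      · exact fun h => h.2
      · rintro rfl
        refine ⟨?_, rfl⟩
        rw [Units.val_one, ZMod.val_one]
        omega
    have hS2 : S.filter (fun a => p - m a = 1) = ∅ := by
      rw [filter_eq_empty_iff]
      intro a ha h
      rw [hSdef, mem_filter] at ha
      have hma : m a = k := by have := hm1 a; omega
      -- `a⁻¹ = -1`, so `a = -1`, whose representative `p - 1` is too large for `S`
      have hk' : ((k : ℕ) : ZMod p) = -1 := by
        rw [eq_neg_iff_add_eq_zero, ← Nat.cast_add_one, ← hk, ZMod.natCast_self]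
      have hinv : (a⁻¹ : (ZMod p)ˣ) = -1 := by
        apply Units.ext
        rw [Units.val_neg, Units.val_one, ← hk', ← hma, hmdef]
        simp only
        rw [ZMod.natCast_zmod_val]
      have ha' : a = -1 := by rw [← inv_inj, hinv, inv_neg, inv_one]
      have hval : (a : ZMod p).val = k := by
        rw [ha', Units.val_neg, Units.val_one, ← hk', ZMod.val_natCast, Nat.mod_eq_of_lt (by omega)]
      have := ha.2
      rw [hval] at this
      omega
    rw [hS1, hS2, card_singleton, card_empty, mul_zero, add_zero]
  · -- the product
    have hreindex : ∏ j ∈ Ico 1 p, ((1 : 𝓞 K) - z ^ j * x) ^ n (p - j)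
        = ∏ i ∈ Ico 1 p, ((1 : 𝓞 K) - z ^ (p - i) * x) ^ n i := by
      refine prod_nbij' (fun j => p - j) (fun i => p - i) ?_ ?_ ?_ ?_ ?_
      · intro j hj; rw [mem_Ico] at hj ⊢; omega
      · intro i hi; rw [mem_Ico] at hi ⊢; omega
      · intro j hj; rw [mem_Ico] at hj; omega
      · intro i hi; rw [mem_Ico] at hi; omega
      · intro j hj
        rw [mem_Ico] at hj
        rw [show p - (p - j) = j by omega]
    rw [hreindex]
    have h2 : ∏ i ∈ Ico 1 p, ((1 : 𝓞 K) - z ^ (p - i) * x) ^ n i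
        = ρ * ∏ i ∈ Ico 1 p, ((x : 𝓞 K) - z ^ i) ^ n i := by
      rw [hρdef, ← prod_mul_distrib]
      refine prod_congr rfl fun i hi => ?_
      rw [mem_Ico] at hi
      rw [hfac i hi.1 hi.2, mul_pow]
    rw [h2, hprodn, hkey, hν₁, hρ₁]
    ring

/-! ### The prime factors of `𝔞` have degree one; multiplicativity of `𝔟 ↦ 𝔟^θ` -/

omit hp [NumberField K] [IsCyclotomicExtension {p} ℚ K] in
/-- A product of principal ideals is principal. [folklore] -/
theorem isPrincipal_multiset_prod {s : Multiset (Ideal (𝓞 K))}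
    (h : ∀ I ∈ s, I.IsPrincipal) : s.prod.IsPrincipal := by
  induction s using Multiset.induction_on with
  | empty => rw [Multiset.prod_zero, Ideal.one_eq_top]; exact ⟨1, by simp⟩
  | cons I s ih =>
    rw [Multiset.prod_cons]
    obtain ⟨a, ha⟩ := h I (Multiset.mem_cons_self _ _)
    obtain ⟨b, hb⟩ := ih fun J hJ => h J (Multiset.mem_cons_of_mem hJ)
    refine ⟨a * b, ?_⟩
    rw [ha, hb, Ideal.submodule_span_eq, Ideal.submodule_span_eq, Ideal.submodule_span_eq,
      Ideal.span_singleton_mul_span_singleton]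

omit hp [IsCyclotomicExtension {p} ℚ K] in
/-- The operators `𝔟 ↦ ∏_{a ∈ S} τ_a(𝔟)` (`𝔟 ↦ 𝔟^θ` for `θ ∈ ℤ[G]` with coefficients `0, 1`) are
multiplicative, so `𝔟^θ` is principal as soon as `P^θ` is principal for every prime factor `P`
of `𝔟`. [folklore] -/
theorem isPrincipal_prod_smul_of_factors {ι : Type*} (S : Finset ι) (τ : ι → (K ≃ₐ[ℚ] K))
    {𝔟 : Ideal (𝓞 K)} (h𝔟 : 𝔟 ≠ ⊥)
    (h : ∀ P ∈ UniqueFactorizationMonoid.factors 𝔟, (∏ a ∈ S, τ a • P).IsPrincipal) :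
    (∏ a ∈ S, τ a • 𝔟).IsPrincipal := by
  classical
  let T : Ideal (𝓞 K) →* Ideal (𝓞 K) :=
    { toFun := fun I => ∏ a ∈ S, τ a • I
      map_one' := by simp only [smul_one, prod_const_one]
      map_mul' := fun I J => by simp only [smul_mul', prod_mul_distrib] }
  have hfac : (UniqueFactorizationMonoid.factors 𝔟).prod = 𝔟 :=
    associated_iff_eq.mp (UniqueFactorizationMonoid.factors_prod h𝔟)
  have : T 𝔟 = ((UniqueFactorizationMonoid.factors 𝔟).map T).prod := by
    rw [← map_multiset_prod, hfac]
  change (T 𝔟).IsPrincipal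
  rw [this]
  refine isPrincipal_multiset_prod fun I hI => ?_
  obtain ⟨P, hP, rfl⟩ := Multiset.mem_map.mp hI
  exact h P hP

/-- **The primes dividing `x - ζ_p` have degree one.** If a non-zero prime `P` of `ℤ[ζ_p]`
contains `x - ζ_p` for an integer `x`, then `ℤ → ℤ[ζ_p]/P` is onto (`ℤ[ζ_p]` is generated by
`ζ_p ≡ x`), so the residue field is the prime field and the norm of `P` is a prime number.
[folklore] -/
theorem absNorm_prime_of_sub_toInteger_mem {P : Ideal (𝓞 K)} [hPp : P.IsPrime] (hP0 : P ≠ ⊥)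
    {x : ℤ} (hx : (x : 𝓞 K) - hζ.toInteger ∈ P) : (Ideal.absNorm P).Prime := by
  classical
  haveI : P.IsMaximal := hPp.isMaximal hP0
  letI : Field (𝓞 K ⧸ P) := Ideal.Quotient.field P
  haveI : Finite (𝓞 K ⧸ P) := Ring.HasFiniteQuotients.finiteQuotient hP0
  letI : Fintype (𝓞 K ⧸ P) := Fintype.ofFinite _
  -- every residue class is the class of an integer
  have hsurj : ∀ w : 𝓞 K ⧸ P, ∃ m : ℤ, (m : 𝓞 K ⧸ P) = w := by
    intro w
    obtain ⟨w, rfl⟩ := Ideal.Quotient.mk_surjective w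
    have hw : w ∈ Algebra.adjoin ℤ {hζ.toInteger} := by
      rw [IsCyclotomicExtension.Rat.adjoin_singleton_eq_top hζ]; trivial
    rw [Algebra.adjoin_singleton_eq_range_aeval] at hw
    obtain ⟨f, rfl⟩ := hw
    refine ⟨f.eval x, ?_⟩
    have hzx : Ideal.Quotient.mk P hζ.toInteger = algebraMap ℤ (𝓞 K ⧸ P) x := by
      rw [eq_intCast, ← map_intCast (Ideal.Quotient.mk P) x, Ideal.Quotient.mk_eq_mk_iff_sub_mem,
        ← neg_sub]
      exact P.neg_mem hx
    calc ((f.eval x : ℤ) : 𝓞 K ⧸ P) = algebraMap ℤ (𝓞 K ⧸ P) (f.eval x) := (eq_intCast _ _).symm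
      _ = Polynomial.aeval (algebraMap ℤ (𝓞 K ⧸ P) x) f :=
          (Polynomial.aeval_algebraMap_apply_eq_algebraMap_eval x f).symm
      _ = Polynomial.aeval (Ideal.Quotient.mk P hζ.toInteger) f := by rw [hzx]
      _ = Ideal.Quotient.mkₐ ℤ P (Polynomial.aeval hζ.toInteger f) := by
          rw [← Polynomial.aeval_algHom_apply, Ideal.Quotient.mkₐ_eq_mk]
      _ = _ := rfl
  -- hence the residue field has prime order: its order is a power of the characteristic `r`,
  -- and `ZMod r → 𝓞 K ⧸ P` is onto
  set r := ringChar (𝓞 K ⧸ P)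
  haveI : CharP (𝓞 K ⧸ P) r := ringChar.charP _
  obtain ⟨n, hr, hcard⟩ := FiniteField.card (𝓞 K ⧸ P) r
  have hle : Fintype.card (𝓞 K ⧸ P) ≤ r := by
    haveI : NeZero r := ⟨hr.ne_zero⟩
    have hs : Function.Surjective (ZMod.castHom (dvd_refl r) (𝓞 K ⧸ P)) := fun w => by
      obtain ⟨m, rfl⟩ := hsurj w
      exact ⟨m, by rw [map_intCast]⟩
    simpa [ZMod.card] using Fintype.card_le_of_surjective _ hs
  have hge : r ≤ Fintype.card (𝓞 K ⧸ P) := by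
    rw [hcard]
    exact Nat.le_self_pow n.ne_zero r
  have hcardr : Fintype.card (𝓞 K ⧸ P) = r := le_antisymm hle hge
  rw [Ideal.absNorm_apply, Submodule.cardQuot_apply, Nat.card_eq_fintype_card]
  change (Fintype.card (𝓞 K ⧸ P)).Prime
  rwa [hcardr]

/-- For a non-zero solution of Catalan's equation, every prime factor `P` of the ideal `𝔞` with
`(x - ζ_p) = 𝔭 𝔞^q` has prime norm different from `p` (degree one, not above `p`). [folklore] -/
theorem absNorm_prime_of_mem_factors {q : ℕ} (hq : 0 < q) {x : ℤ} {𝔞 : Ideal (𝓞 K)}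
    (hA : Ideal.span {(x : 𝓞 K) - hζ.toInteger} = Ideal.span {hζ.toInteger - 1} * 𝔞 ^ q)
    (hcop : IsCoprime (Ideal.span {hζ.toInteger - 1}) 𝔞) {P : Ideal (𝓞 K)}
    (hP : P ∈ UniqueFactorizationMonoid.factors 𝔞) :
    (Ideal.absNorm P).Prime ∧ Ideal.absNorm P ≠ p := by
  have h𝔞0 : 𝔞 ≠ ⊥ := by
    rintro rfl
    have h0 : UniqueFactorizationMonoid.factors (⊥ : Ideal (𝓞 K)) = 0 := by
      rw [← Ideal.zero_eq_bot, UniqueFactorizationMonoid.factors_zero]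
    rw [h0] at hP
    exact Multiset.notMem_zero _ hP
  have hPprime : Prime P := UniqueFactorizationMonoid.prime_of_factor P hP
  haveI : P.IsPrime := Ideal.isPrime_of_prime hPprime
  have hP0 : P ≠ ⊥ := hPprime.ne_zero
  have hPdvd : P ∣ 𝔞 := UniqueFactorizationMonoid.dvd_of_mem_factors hP
  -- `x - ζ ∈ P`
  have hx : (x : 𝓞 K) - hζ.toInteger ∈ P := by
    have : P ∣ Ideal.span {(x : 𝓞 K) - hζ.toInteger} := by
      rw [hA]
      exact dvd_mul_of_dvd_right (dvd_pow hPdvd hq.ne') _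
    exact (Ideal.dvd_iff_le.mp this) (Ideal.mem_span_singleton_self _)
  refine ⟨absNorm_prime_of_sub_toInteger_mem hζ hP0 hx, fun hnorm => ?_⟩
  -- if the norm were `p` then `p ∈ P`, so `P ∣ (ζ - 1)`, contradicting the coprimality
  have hpP : (p : 𝓞 K) ∈ P := by
    have := Ideal.absNorm_mem P
    rwa [hnorm] at this
  have h1 : P ∣ Ideal.span {hζ.toInteger - 1} := by
    have h2 : P ∣ Ideal.span {hζ.toInteger - 1} ^ (p - 1) := by
      rw [Ideal.span_singleton_pow, Ideal.dvd_span_singleton]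
      obtain ⟨u, hu⟩ := IsCyclotomicExtension.Rat.associated_zeta_sub_one_pow_prime p hζ
      have : (hζ.toInteger - 1) ^ (p - 1) = (p : 𝓞 K) * ↑u⁻¹ := by
        rw [← hu, Units.mul_inv_cancel_right]
      rw [this]
      exact P.mul_mem_right _ hpP
    exact hPprime.dvd_of_dvd_pow h2
  have := hcop.isUnit_of_dvd' h1 hPdvd
  rw [Ideal.isUnit_iff] at this
  exact hPprime.not_unit (Ideal.isUnit_iff.mpr this)

/-! ### Theorem 10.2 and Theorem I from annihilation of the degree-one primes -/

/-- **[Schoof2009, Theorem 10.2 and Theorem I for `(p, q)`] from Kummer–Stickelberger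
annihilation for `ι θ₂` on primes of degree one.** Let `p, q` be odd primes, `x, y` non-zero
integers with `x ^ p - y ^ q = 1`, and `K` a `p`-th cyclotomic field. Suppose that for every
ideal `𝔩` of `𝓞 K` of prime norm `ℓ ≠ p` (the primes of residue degree one not above `p`) the
ideal `∏_{1 ≤ a ≤ (p-1)/2} σ_a⁻¹(𝔩)` is principal — Stickelberger's theorem
[Schoof2009, Theorem 9.5] for the element `ι θ₂` of the Stickelberger ideal, i.e. the prime
factorisation of the Jacobi sum `J(χ, χ)` of the `p`-th power residue character modulo `𝔩`; this
is the only unproved input. Then `q² ∣ x` (Theorem 10.2) and `p ^ (q-1) ≡ 1 (mod q²)`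
(Theorem I): the ideal `𝔞` with `(x - ζ_p) = 𝔭 𝔞^q` (Propositions 7.2–7.3) has only prime factors
of degree one (they contain `x - ζ_p`), so `𝔞^(ιθ₂)` is principal and Proposition 10.1,
Theorem 10.2 apply. [cite: Schoof2009, Theorem 10.2] [cite: Schoof2009, Theorem I (Ch. 10, p. 68)] -/
theorem sq_dvd_and_isWieferich_of_isPrincipal (hpo : Odd p) {q : ℕ} (hq : q.Prime)
    (hqo : Odd q) {x y : ℤ} (hx : x ≠ 0) (hy : y ≠ 0) (h : x ^ p - y ^ q = 1)
    (hKS : ∀ 𝔩 : Ideal (𝓞 K), (Ideal.absNorm 𝔩).Prime → Ideal.absNorm 𝔩 ≠ p →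
      (∏ a ∈ Finset.univ.filter (fun a : (ZMod p)ˣ => (a : ZMod p).val ≤ (p - 1) / 2),
        (IsCyclotomicExtension.Rat.galEquivZMod p K).symm a⁻¹ • 𝔩).IsPrincipal) :
    (q : ℤ) ^ 2 ∣ x ∧ IsWieferich p q := by
  have hζ := IsCyclotomicExtension.zeta_spec p ℚ K
  have hp3 : 3 ≤ p := by
    have := hp.out.two_le
    obtain ⟨k, hk⟩ := hpo
    omega
  have hpq : p ≠ q := by
    rintro rfl
    exact pow_sub_pow_ne_one hpo hp3 hx hy h
  obtain ⟨𝔞, h𝔞⟩ := span_sub_zeta_pow_eq hζ hq hpo hqo hx hy h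
  obtain ⟨hA, hcop⟩ := h𝔞 1 (mem_Ico.mpr ⟨le_rfl, hp.out.one_lt⟩)
  rw [pow_one] at hA
  -- `𝔞 ≠ 0` (as `x - ζ ≠ 0`)
  have h𝔞0 : 𝔞 1 ≠ ⊥ := by
    intro h0
    rw [h0, ← Ideal.zero_eq_bot, zero_pow hq.ne_zero, mul_zero, Ideal.zero_eq_bot,
      Ideal.span_singleton_eq_bot, sub_eq_zero] at hA
    have hzp : hζ.toInteger ^ p = 1 := hζ.toInteger_isPrimitiveRoot.pow_eq_one
    rw [← hA] at hzp
    have h2 : x ^ p = 1 := by exact_mod_cast hzp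
    rcases Int.isUnit_iff.mp (IsUnit.of_pow_eq_one h2 hp.out.ne_zero) with rfl | rfl
    · exact hζ.zeta_sub_one_prime'.ne_zero (by rw [← hA]; push_cast; ring)
    · rw [hpo.neg_pow, one_pow] at h2
      norm_num at h2
  have hprinc := isPrincipal_prod_smul_of_factors
    (Finset.univ.filter (fun a : (ZMod p)ˣ => (a : ZMod p).val ≤ (p - 1) / 2))
    (fun a => (IsCyclotomicExtension.Rat.galEquivZMod p K).symm a⁻¹) h𝔞0 fun P hP =>
      hKS P (absNorm_prime_of_mem_factors hζ hq.pos hA hcop hP).1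
        (absNorm_prime_of_mem_factors hζ hq.pos hA hcop hP).2
  obtain ⟨n, β, hn1, hβ⟩ :=
    exists_prod_one_sub_zeta_pow_mul_eq_pow_of_isPrincipal hζ hpo hq hqo hpq x hA hprinc
  exact isWieferich_of_prod_one_sub_zeta_pow_mul_eq_pow hζ hq hpo hqo hx hy h hβ
    ⟨p - 1, mem_Ico.mpr ⟨by omega, by omega⟩, by rw [hn1]; exact hq.not_dvd_one⟩

end Cyclotomic

/-- **Mihăilescu's Theorem I from Stickelberger's theorem for `ι θ₂` on degree-one primes of
`ℚ(ζ_p)` and `ℚ(ζ_q)`** ([Schoof2009, Chapter 10]; P. Mihăilescu, J. Number Theory **99**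
(2003)). For odd primes `p, q` and non-zero integers with `x ^ p - y ^ q = 1`: if
`∏_{1 ≤ a ≤ (n-1)/2} σ_a⁻¹(𝔩)` is principal for every ideal `𝔩` of prime norm `≠ n` in the
`n`-th cyclotomic field, for `n = p` and `n = q`, then `p ^ (q-1) ≡ 1 (mod q²)` and
`q ^ (p-1) ≡ 1 (mod p²)` — the hypothesis `hI` of `Catalan.mihailescu_of_mihailescu_theorems`
(`CatalanAssembly`). The second congruence is the first for the solution
`(-y) ^ q - (-x) ^ p = 1`. [cite: Schoof2009, Theorem I (Ch. 10, p. 68)] -/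
theorem theoremI_of_isPrincipal {p q : ℕ} [hp : Fact p.Prime] [hq : Fact q.Prime] (hpo : Odd p)
    (hqo : Odd q) {K : Type*} [Field K] [NumberField K] [IsCyclotomicExtension {p} ℚ K]
    {L : Type*} [Field L] [NumberField L] [IsCyclotomicExtension {q} ℚ L]
    (hKSp : ∀ 𝔩 : Ideal (𝓞 K), (Ideal.absNorm 𝔩).Prime → Ideal.absNorm 𝔩 ≠ p →
      (∏ a ∈ Finset.univ.filter (fun a : (ZMod p)ˣ => (a : ZMod p).val ≤ (p - 1) / 2),
        (IsCyclotomicExtension.Rat.galEquivZMod p K).symm a⁻¹ • 𝔩).IsPrincipal)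
    (hKSq : ∀ 𝔩 : Ideal (𝓞 L), (Ideal.absNorm 𝔩).Prime → Ideal.absNorm 𝔩 ≠ q →
      (∏ a ∈ Finset.univ.filter (fun a : (ZMod q)ˣ => (a : ZMod q).val ≤ (q - 1) / 2),
        (IsCyclotomicExtension.Rat.galEquivZMod q L).symm a⁻¹ • 𝔩).IsPrincipal)
    {x y : ℤ} (hx : x ≠ 0) (hy : y ≠ 0) (h : x ^ p - y ^ q = 1) :
    IsWieferich p q ∧ IsWieferich q p := by
  refine ⟨(sq_dvd_and_isWieferich_of_isPrincipal hpo hq.out hqo hx hy h hKSp).2, ?_⟩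
  have h' : (-y) ^ q - (-x) ^ p = 1 := by rw [hqo.neg_pow, hpo.neg_pow]; linarith
  exact (sq_dvd_and_isWieferich_of_isPrincipal hqo hp.out hpo (neg_ne_zero.mpr hy)
    (neg_ne_zero.mpr hx) h' hKSq).2

end Catalan

end Literature.NumberTheory.DiophantineGeometry
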